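import Mathlib
import Summits.ABC.ABC.Statement
import Summits.ABC.ABC.Theorems.SoloInformedOnePrime

/-!
# Square divisors of `2^n - 1` under `ABC` (solo-ABC-informed, session 6)

Companion of `Summits/ABC/ABC/Theorems/SoloInformedOnePrime.lean`.  The critical case of the
one-prime face in the Mersenne regime is `v_p(2^n - 1) = 2` at a prime `p ≈ 2^{n/2}`; collecting all
such primes, the Diophantine object is the largest square divisor `Y²` of `2^n - 1`, i.e. the
factorisation `2^n - 1 = m · Y²`.  Three elementary statements:

* (trivial / Liouville-type) `Y² ∣ N ≠ 0 → Y · rad N ≤ N`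
  (`soloInformed_mul_radical_le_of_sq_dvd`), so `Y ≤ (2^n - 1) / rad(2^n - 1)` and trivially
  `Y < 2^{n/2}`;
* (`ABC` on the family `(1, 2^n - 1, 2^n)`) `ABC → ∀ ε > 0, ∃ K, ∀ n ≥ 1, ∀ Y, Y² ∣ 2^n - 1 →
  log Y ≤ ε · n · log 2 + K` (`soloInformed_log_sqDivisor_mersenne_of_abc`), equivalently
  `Y ≤ K' · 2^{ε n}` (`soloInformed_sqDivisor_mersenne_of_abc`): under `ABC` the square part of a
  Mersenne number has sub-exponential size;
* (the cofactor) `ABC → ∀ ε > 0, ∃ K, ∀ n ≥ 1, ∀ Y m, 2^n - 1 = m · Y² →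
  (1 - ε) · n · log 2 ≤ log m + K` (`soloInformed_log_sqfreePart_mersenne_of_abc`): the squarefree
  part of `2^n - 1` is `≥ 2^{(1-ε)n - O_ε(1)}`.

Context (not formalised here).  Writing `m₀ = sqf(2^n - 1) ≡ 7 (mod 8)` (`n ≥ 3`), the element
`β = (1 + Y√(-m₀))/2` has norm `2^{n-2}` and `β + β̄ = 1`, so `(β) = 𝔭₂^{n-2}` for a prime `𝔭₂`
above `2` in `ℚ(√(-m₀))`: `m₀ Y² + 1 = 2^n` is a generalized Ramanujan–Nagell equation and the class
of `𝔭₂` has order dividing `n - 2`.  Gross–Rohrlich (Invent. Math. 44, 1978) and Cohn (Proc. AMS 130,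
2002) show the order is exactly `n - 2` (`n > 2`, `n ≠ 6`), whence, with Dirichlet's bound
`h(-d) ≪ √d log d`, unconditionally `sqf(2^n - 1) ≫ n² / log² n` — against the `2^{(1-ε)n}` of the
last statement above.  Report: `run/shared/lean/ideation/ABC/solo-informed/paper/paper.md` §2.4.
[folklore]
-/

namespace Summit.ABC.ABC.Theorems

open Literature.NumberTheory.DiophantineGeometry UniqueFactorizationMonoid

/-! ### The trivial bound: `Y · rad N ≤ N` when `Y² ∣ N` -/

/-- For `N ≠ 0` and `Y² ∣ N`, `Y * rad N ≤ N` (write `N = Y² m`; then `rad N ∣ rad Y · rad m ∣ Y m`).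
[folklore] -/
theorem soloInformed_mul_radical_le_of_sq_dvd {N Y : ℕ} (hN : N ≠ 0) (hY : Y ^ 2 ∣ N) :
    Y * radical N ≤ N := by
  obtain ⟨m, hm⟩ := hY
  have hdvd : radical N ∣ Y * m := by
    rw [hm]
    calc radical (Y ^ 2 * m) ∣ radical (Y ^ 2) * radical m := radical_mul_dvd
      _ = radical Y * radical m := by rw [radical_pow Y (by norm_num)]
      _ ∣ Y * m := mul_dvd_mul radical_dvd_self radical_dvd_self
  have h2 : Y * radical N ∣ N := by
    have : Y * radical N ∣ Y * (Y * m) := mul_dvd_mul_left Y hdvd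
    have hN' : N = Y * (Y * m) := by rw [hm]; ring
    rw [hN'] at this ⊢
    simpa using this
  exact Nat.le_of_dvd (Nat.pos_of_ne_zero hN) h2

/-! ### `ABC` ⟹ the square part of `2^n - 1` is sub-exponential -/

/-- **`ABC` ⟹ square divisors of Mersenne numbers are small (logarithmic form).**
`ABC → ∀ ε > 0, ∃ K, ∀ n ≥ 1, ∀ Y, Y² ∣ 2^n - 1 → log Y ≤ ε · n · log 2 + K`.
(From `2^n < C · (2 rad(2^n-1))^{1+ε}` and `Y · rad(2^n - 1) ≤ 2^n - 1`.)  Unconditionally only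
`log Y ≤ (n log 2)/2 - log n + O(log log n)` is known (class group of `ℚ(√(1-2^n))`). [folklore] -/
theorem soloInformed_log_sqDivisor_mersenne_of_abc (h : _root_.ABC) :
    ∀ ε : ℝ, 0 < ε → ∃ K : ℝ, ∀ n Y : ℕ, 0 < n → Y ^ 2 ∣ 2 ^ n - 1 →
      Real.log Y ≤ ε * n * Real.log 2 + K := by
  intro ε hε
  obtain ⟨C, hC, hC'⟩ := (_root_.ABC_iff.mp h) ε hε
  refine ⟨Real.log C + (1 + ε) * Real.log 2, fun n Y hn hY => ?_⟩
  have hM : 2 ^ n - 1 ≠ 0 := by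
    have := Nat.one_lt_two_pow hn.ne'
    omega
  have hY0 : Y ≠ 0 := by
    rintro rfl
    rw [zero_pow two_ne_zero, zero_dvd_iff] at hY
    exact hM hY
  have h1 := hC' 1 (2 ^ n - 1) (2 ^ n) (soloInformed_isABCTriple_mersenne hn)
  set r : ℝ := ((radical (2 ^ n - 1) : ℕ) : ℝ) with hr
  have hr0 : 0 < r := by rw [hr]; exact_mod_cast Nat.radical_pos _
  have hradle : ((rad 1 (2 ^ n - 1) (2 ^ n) : ℕ) : ℝ) ≤ 2 * r := by
    rw [hr]; exact_mod_cast soloInformed_rad_mersenne_le hn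
  have h2 : ((2 : ℝ)) ^ n < C * (2 * r) ^ (1 + ε) := by
    calc ((2 : ℝ)) ^ n = ((2 ^ n : ℕ) : ℝ) := by push_cast; ring
      _ < C * ((rad 1 (2 ^ n - 1) (2 ^ n) : ℕ) : ℝ) ^ (1 + ε) := h1
      _ ≤ C * (2 * r) ^ (1 + ε) := by gcongr
  -- take logarithms: n log 2 < log C + (1+ε)(log 2 + log r)
  have hlog := Real.log_lt_log (by positivity) h2
  rw [Real.log_pow, Real.log_mul hC.ne' (by positivity),
    Real.log_rpow (by positivity), Real.log_mul (by norm_num) hr0.ne'] at hlog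
  -- Y * r ≤ 2^n - 1 ≤ 2^n, so log Y + log r ≤ n log 2
  have hY1 : (1 : ℝ) ≤ Y := by exact_mod_cast Nat.one_le_iff_ne_zero.mpr hY0
  have hYr : (Y : ℝ) * r ≤ (2 : ℝ) ^ n := by
    have hnat : Y * radical (2 ^ n - 1) ≤ 2 ^ n - 1 :=
      soloInformed_mul_radical_le_of_sq_dvd hM hY
    have h' : ((Y * radical (2 ^ n - 1) : ℕ) : ℝ) ≤ ((2 ^ n - 1 : ℕ) : ℝ) := by
      exact_mod_cast hnat
    have h'' : ((2 ^ n - 1 : ℕ) : ℝ) ≤ (2 : ℝ) ^ n := by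
      rw [Nat.cast_sub Nat.one_le_two_pow]; push_cast; linarith
    rw [hr]
    push_cast at h'
    exact h'.trans h''
  have hlogYr : Real.log Y + Real.log r ≤ n * Real.log 2 := by
    have := Real.log_le_log (by positivity) hYr
    rwa [Real.log_mul (by positivity) hr0.ne', Real.log_pow] at this
  have hlogY : 0 ≤ Real.log Y := Real.log_nonneg hY1
  have hl2 : 0 < Real.log 2 := Real.log_pos (by norm_num)
  nlinarith [hlog, hlogYr, hlogY, hl2, hε, mul_le_mul_of_nonneg_left hlogYr hε.le,
    mul_nonneg hε.le hlogY]

/-- **`ABC` ⟹ square divisors of Mersenne numbers are small (multiplicative form).**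
`ABC → ∀ ε > 0, ∃ K > 0, ∀ n ≥ 1, ∀ Y, Y² ∣ 2^n - 1 → Y ≤ K · 2^{ε n}`; the trivial bound is
`Y < 2^{n/2}`. [folklore] -/
theorem soloInformed_sqDivisor_mersenne_of_abc (h : _root_.ABC) :
    ∀ ε : ℝ, 0 < ε → ∃ K : ℝ, 0 < K ∧ ∀ n Y : ℕ, 0 < n → Y ^ 2 ∣ 2 ^ n - 1 →
      (Y : ℝ) ≤ K * (2 : ℝ) ^ (ε * n) := by
  intro ε hε
  obtain ⟨K, hK⟩ := soloInformed_log_sqDivisor_mersenne_of_abc h ε hε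
  refine ⟨Real.exp K, Real.exp_pos K, fun n Y hn hY => ?_⟩
  have hM : 2 ^ n - 1 ≠ 0 := by
    have := Nat.one_lt_two_pow hn.ne'
    omega
  have hY0 : Y ≠ 0 := by
    rintro rfl
    rw [zero_pow two_ne_zero, zero_dvd_iff] at hY
    exact hM hY
  have hYpos : (0 : ℝ) < Y := by exact_mod_cast Nat.pos_of_ne_zero hY0
  have h1 := hK n Y hn hY
  have h2 : Real.log Y ≤ Real.log (Real.exp K * (2 : ℝ) ^ (ε * n)) := by
    rw [Real.log_mul (Real.exp_pos K).ne' (by positivity), Real.log_exp,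
      Real.log_rpow (by norm_num)]
    linarith
  exact (Real.log_le_log_iff hYpos (by positivity)).mp h2

/-- **`ABC` ⟹ the squarefree part of `2^n - 1` is `≥ 2^{(1-ε)n - O_ε(1)}`.**
`ABC → ∀ ε > 0, ∃ K, ∀ n ≥ 1, ∀ Y m, 2^n - 1 = m · Y² → (1 - ε) · n · log 2 ≤ log m + K`.
Unconditionally `log sqf(2^n - 1) ≥ 2 log n - 2 log log n - O(1)` is what the class group gives
(report §2.4). [folklore] -/
theorem soloInformed_log_sqfreePart_mersenne_of_abc (h : _root_.ABC) :
    ∀ ε : ℝ, 0 < ε → ∃ K : ℝ, ∀ n Y m : ℕ, 0 < n → 2 ^ n - 1 = m * Y ^ 2 →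
      (1 - ε) * n * Real.log 2 ≤ Real.log m + K := by
  intro ε hε
  obtain ⟨K, hK⟩ := soloInformed_log_sqDivisor_mersenne_of_abc h (ε / 2) (by positivity)
  refine ⟨2 * K + Real.log 2, fun n Y m hn hfac => ?_⟩
  have hM : 2 ^ n - 1 ≠ 0 := by
    have := Nat.one_lt_two_pow hn.ne'
    omega
  have hY : Y ^ 2 ∣ 2 ^ n - 1 := ⟨m, by rw [hfac]; ring⟩
  have hm0 : m ≠ 0 := by
    rintro rfl
    rw [zero_mul] at hfac
    exact hM hfac
  have hY0 : Y ≠ 0 := by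
    rintro rfl
    rw [zero_pow two_ne_zero, mul_zero] at hfac
    exact hM hfac
  have h1 := hK n Y hn hY
  have hmpos : (0 : ℝ) < m := by exact_mod_cast Nat.pos_of_ne_zero hm0
  have hYpos : (0 : ℝ) < Y := by exact_mod_cast Nat.pos_of_ne_zero hY0
  have hcast : ((2 ^ n - 1 : ℕ) : ℝ) = (m : ℝ) * (Y : ℝ) ^ 2 := by
    rw [hfac]; push_cast; ring
  have hlow : (2 : ℝ) ^ n / 2 ≤ ((2 ^ n - 1 : ℕ) : ℝ) := by
    rw [Nat.cast_sub Nat.one_le_two_pow]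
    push_cast
    have : (2 : ℝ) ≤ 2 ^ n := by
      calc (2 : ℝ) = 2 ^ 1 := by norm_num
        _ ≤ 2 ^ n := pow_le_pow_right₀ (by norm_num) hn
    linarith
  have hlog1 : Real.log ((2 : ℝ) ^ n / 2) ≤ Real.log ((m : ℝ) * (Y : ℝ) ^ 2) := by
    rw [← hcast]; exact Real.log_le_log (by positivity) hlow
  rw [Real.log_div (by positivity) (by norm_num), Real.log_pow,
    Real.log_mul hmpos.ne' (by positivity), Real.log_pow] at hlog1
  push_cast at hlog1
  linarith

end Summit.ABC.ABC.Theorems
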